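import Literature.NumberTheory.LFunctions.ConreyIwaniec2002LMeanSquare
import Literature.NumberTheory.LFunctions.ConreyIwaniec2002Prop81LargeCloseOfProp64Holds
import Literature.NumberTheory.LFunctions.ConreyIwaniec2002Prop91Algebra
import Literature.NumberTheory.LFunctions.WeightedDiscreteMeanValue
import Literature.NumberTheory.LFunctions.ClassGroupLFunctionInversion
import HarnessLib

/-!
# Conrey–Iwaniec (2002), Proposition 9.1 WITHOUT the close-companion restriction

B. Conrey, H. Iwaniec, *Spacing of zeros of Hecke L-functions and the class number problem*,
Acta Arith. 103 (2002), §§8–9 [held text `paper:arxiv-math_0111012`, p0018–p0020]: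

> (8.4) To each point `s_r` we associate a point `s′_r = ½ + it′_r`. … **Proposition 9.1.** Let
> `S(T)` be a set of points satisfying (8.1)–(8.3) with `T ≥ 2`. Then
> `E(T) ≪ T(log q)^6 + Tℒ(T)^{1/2}(log T)²(log q)^{5/2}` (9.7), the implied constant absolute,

`E(T) = Σ_s |ℓ(s)M̄(s) − x(s)|` (9.6), `ℓ(s) = (L(s) − L(s′))/(s − s′)`. The printed statement puts
NO condition on the companions `s′`; the printed PROOF (via Proposition 8.1 and (7.23), whose sums
at `s′` are estimated by mean values over the well-spaced `s`) is a CLOSE-companion argument, and the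
tree accordingly holds (9.7) for companions `|t′ − t| ≤ 1` (`prop91_close_of_proposition64`, modulo
Proposition 6.4). For PROPOSITION 8.1 the restriction is essential (`D(T)` is quadratic in
`L(s′)`: a far companion at a large value of `L` needs a pointwise = subconvex bound). THIS FILE
shows that for PROPOSITION 9.1 it is NOT: `E(T)` is linear in `L(s′)`, and for a far companion
(`|t − t′| > 1`)

  `|ℓ(s)M̄(s) − x(s)| ≤ |L(s)||M(s)| + |L(s′)||M(s)|/|t − t′| + 2`      (`far_pointwise`),

so that by Cauchy `Σ_s |L(s′_s)||M(s)|/|t_s − t′_s| ≤ (Σ_s|M(s)|²)^{1/2}(Σ_s |L(s′_s)|²/|t_s − t′_s|²)^{1/2}`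
and, grouping the companions by `k = ⌊t′_s⌋` (the `s` are `1`-spaced:
`Σ_{⌊t′_s⌋ = k} |t_s − t′_s|^{−2} ≤ 13π`, `sum_inv_sq_fiber_le`),

  `Σ_s |L(s′_s)|²/|t_s − t′_s|² ≤ 13π · Σ_k max_{u ∈ [k,k+1]} |L(½+iu)|²`      (`far_sum_le_sup_sum`),

where the maximisers `u_k` with `k` even, resp. odd, form two `1`-SPACED point sets
(`sum_parity_class_le`): the right side is a sum of six DISCRETE MEAN SQUARES OF `L(½+it,ψ)` over
`1`-spaced points of the dyadic windows at `T/2`, `T`, `2T` — the tree's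
`sum_norm_classGroupLFunction_sq_le` (from Proposition 6.4). RESULT (PROVED, modulo the typed
Proposition 6.4 = binder `h64` only):

* `prop91_far_of_proposition64` — (9.7) VERBATIM for `1`-spaced `S ⊂ (T,2T]` and ANY companion map
  with `|t′(t) − t| ≤ T/4` (close or far), in the range `2q^66 ≤ T`, `2e^{(log q)²} ≤ T` (the
  windows at `T/2` need the range of `sum_norm_classGroupLFunction_sq_le`).

The residual restriction `|t′ − t| ≤ T/4` only locates the companions inside `(T/2, 4T]`, where the
discrete mean squares are available; the form of record of input I6b (the I6 skeleton's binder
`stub_prop91_large`: `q^65 ≤ T`, `t′` arbitrary) differs from this by range constants only.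
No definition, no named fact.

«The programme SEARCHES and TYPES; no claim about Landau–Siegel zeros, Theorems 1–2 of
arXiv:2211.02515 or a repaired Margin232 until a kernel theorem says so.»

## References
* [ConreyIwaniec2002] B. Conrey, H. Iwaniec, Acta Arith. 103 (2002) 259–312, arXiv:math/0111012:
  Lemma 5.3, Proposition 7.1 (7.12), (7.19)–(7.20), §8 (8.1)–(8.4), Proposition 9.1 (9.6)–(9.7).
-/

noncomputable section

open scoped NumberField
open Complex

namespace Literature.NumberTheory.LFunctions

namespace ConreyIwaniec2002

open NumberField

/-! ### §1. A far companion, pointwise -/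

/-- `|s − s′| = |t − t′|` for `s = ½ + it`, `s′ = ½ + it′`. [cite: ConreyIwaniec2002, §8 (8.1)–(8.4)] -/
theorem norm_half_sub_half (t t' : ℝ) :
    ‖(1 / 2 + t * I : ℂ) - (1 / 2 + t' * I)‖ = |t' - t| := by
  rw [show (1 / 2 + t * I : ℂ) - (1 / 2 + t' * I) = ((t - t' : ℝ) : ℂ) * I by push_cast; ring,
    norm_mul, Complex.norm_I, mul_one, Complex.norm_real, Real.norm_eq_abs, abs_sub_comm]

/-- **`|ℓ(s)| ≤ (|L(s)| + |L(s′)|)/|t − t′|`** for distinct `s = ½+it`, `s′ = ½+it′`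
(`ℓ(s) = (L(s) − L(s′))/(s − s′)`, (7.19)). [cite: ConreyIwaniec2002, §7 (7.19)] -/
theorem norm_dividedDifference_half_le (L : ℂ → ℂ) {t t' : ℝ} (h : t' ≠ t) :
    ‖dividedDifference L (1 / 2 + t * I) (1 / 2 + t' * I)‖ ≤
      (‖L (1 / 2 + t * I)‖ + ‖L (1 / 2 + t' * I)‖) / |t' - t| := by
  have hne : (1 / 2 + t' * I : ℂ) ≠ 1 / 2 + t * I := by
    intro e
    apply h
    have := congrArg Complex.im e
    simpa using this
  unfold dividedDifference
  rw [if_neg hne, norm_div, norm_half_sub_half]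
  exact div_le_div_of_nonneg_right (norm_sub_le _ _) (abs_nonneg _)

/-- **`|x(s)| ≤ 2/|t − t′|`** for distinct `s = ½+it`, `s′ = ½+it′` (`x(s) = (X(s) − X(s′))/(s − s′)`
(7.20), `|X| = 1` on the critical line (7.26)). [cite: ConreyIwaniec2002, §7 (7.20), (7.26)] -/
theorem norm_xQuot_le_two_div {q : ℕ} (hq : 0 < q) {t t' : ℝ} (h : t' ≠ t) :
    ‖xQuot q (1 / 2 + t * I) (1 / 2 + t' * I)‖ ≤ 2 / |t' - t| := by
  have hne : (1 / 2 + t' * I : ℂ) ≠ 1 / 2 + t * I := by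
    intro e
    apply h
    have := congrArg Complex.im e
    simpa using this
  unfold xQuot dividedDifference
  rw [if_neg hne, norm_div, norm_half_sub_half]
  refine div_le_div_of_nonneg_right ?_ (abs_nonneg _)
  calc ‖afeX q (1 / 2 + t * I) - afeX q (1 / 2 + t' * I)‖
      ≤ ‖afeX q (1 / 2 + t * I)‖ + ‖afeX q (1 / 2 + t' * I)‖ := norm_sub_le _ _
    _ = 2 := by rw [norm_afeX_half q hq t, norm_afeX_half q hq t']; norm_num

variable (K : Type) [Field K] [NumberField K]

/-- **A FAR companion, pointwise**: for `|t′ − t| > 1`,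
`|ℓ(s)M̄(s) − x(s)| ≤ |L(s)||M(s)| + |L(s′)||M(s)|/|t − t′| + 2` — the summand of `E(T)` (9.6) is
LINEAR in `L(s′)`. [cite: ConreyIwaniec2002, §9 (9.6); (7.19)–(7.20)] -/
theorem far_pointwise (ψ : ClassGroup (𝓞 K) →* ℂˣ) {q : ℕ} (hq : 0 < q) {t t' : ℝ}
    (h : 1 < |t' - t|) :
    ‖dividedDifference (classGroupLFunction K ψ) (1 / 2 + t * I) (1 / 2 + t' * I) *
          starRingEnd ℂ (shortInvSum K ψ q (1 / 2 + t * I)) -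
        xQuot q (1 / 2 + t * I) (1 / 2 + t' * I)‖ ≤
      ‖classGroupLFunction K ψ (1 / 2 + t * I)‖ * ‖shortInvSum K ψ q (1 / 2 + t * I)‖ +
        ‖classGroupLFunction K ψ (1 / 2 + t' * I)‖ * ‖shortInvSum K ψ q (1 / 2 + t * I)‖ /
          |t' - t| + 2 := by
  have hne : t' ≠ t := by
    intro e; rw [e, sub_self, abs_zero] at h; linarith
  have hd0 : 0 < |t' - t| := by linarith
  set d : ℝ := |t' - t| with hd
  set Lt := classGroupLFunction K ψ (1 / 2 + t * I)
  set Lt' := classGroupLFunction K ψ (1 / 2 + t' * I)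
  set M := shortInvSum K ψ q (1 / 2 + t * I)
  have hℓ := norm_dividedDifference_half_le (classGroupLFunction K ψ) hne
  have hx := norm_xQuot_le_two_div hq hne
  have hM0 : 0 ≤ ‖M‖ := norm_nonneg _
  calc ‖dividedDifference (classGroupLFunction K ψ) (1 / 2 + t * I) (1 / 2 + t' * I) *
            starRingEnd ℂ M - xQuot q (1 / 2 + t * I) (1 / 2 + t' * I)‖
      ≤ ‖dividedDifference (classGroupLFunction K ψ) (1 / 2 + t * I) (1 / 2 + t' * I) *
            starRingEnd ℂ M‖ + ‖xQuot q (1 / 2 + t * I) (1 / 2 + t' * I)‖ := norm_sub_le _ _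
    _ = ‖dividedDifference (classGroupLFunction K ψ) (1 / 2 + t * I) (1 / 2 + t' * I)‖ * ‖M‖ +
          ‖xQuot q (1 / 2 + t * I) (1 / 2 + t' * I)‖ := by rw [norm_mul, RCLike.norm_conj]
    _ ≤ (‖Lt‖ + ‖Lt'‖) / d * ‖M‖ + 2 / d := by gcongr
    _ = ‖Lt‖ * ‖M‖ / d + ‖Lt'‖ * ‖M‖ / d + 2 / d := by ring
    _ ≤ ‖Lt‖ * ‖M‖ + ‖Lt'‖ * ‖M‖ / d + 2 := by
        have h1 : ‖Lt‖ * ‖M‖ / d ≤ ‖Lt‖ * ‖M‖ := div_le_self (by positivity) h.le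
        have h2 : 2 / d ≤ 2 := div_le_self (by norm_num) h.le
        linarith

variable {K}

/-! ### §2. The companions with integer part `k`: `Σ |t − t′|^{−2} ≤ 13π` -/

/-- **Counting lemma.** For a `1`-spaced finite `S ⊂ [−T, T]`, `F ⊆ S`, and companions with
`|t′(t) − m| ≤ ½` and `|t′(t) − t| > 1` for `t ∈ F`: `Σ_{t∈F} |t′(t) − t|^{−2} ≤ 13π`
(`|t′ − t|^{−2} ≤ (13/4)(1 + (m − t)²)^{−1}` and the tree's Poisson-weight density
`Σ_{t∈S}(1 + (m − t)²)^{−1} ≤ 4π`). [cite: ConreyIwaniec2002, §5 (5.11)–(5.12)] -/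
theorem sum_inv_sq_fiber_le {S F : Finset ℝ} {T : ℝ} (hT : 0 ≤ T) (hFS : F ⊆ S)
    (hmem : ∀ t ∈ S, |t| ≤ T) (hsep : ∀ t ∈ S, ∀ u ∈ S, t ≠ u → (1 : ℝ) ≤ |t - u|)
    (t' : ℝ → ℝ) (m : ℝ) (hfib : ∀ t ∈ F, |t' t - m| ≤ 1 / 2 ∧ 1 < |t' t - t|) :
    ∑ t ∈ F, ((t' t - t) ^ 2)⁻¹ ≤ 13 * Real.pi := by
  have hpt : ∀ t ∈ F, ((t' t - t) ^ 2)⁻¹ ≤ (13 / 4) * (1 + (m - t) ^ 2)⁻¹ := by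
    intro t ht
    obtain ⟨h1, h2⟩ := hfib t ht
    set d : ℝ := |t' t - t| with hd
    have htm : |m - t| ≤ 1 / 2 + d := by
      calc |m - t| = |(m - t' t) + (t' t - t)| := by ring_nf
        _ ≤ |m - t' t| + |t' t - t| := abs_add_le _ _
        _ ≤ 1 / 2 + d := by rw [abs_sub_comm] at h1; linarith
    have hsq : (m - t) ^ 2 ≤ (1 / 2 + d) ^ 2 := by
      calc (m - t) ^ 2 = |m - t| ^ 2 := (sq_abs _).symm
        _ ≤ (1 / 2 + d) ^ 2 := pow_le_pow_left₀ (abs_nonneg _) htm 2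
    have hd2 : d ^ 2 = (t' t - t) ^ 2 := sq_abs _
    have hkey : 1 + (m - t) ^ 2 ≤ (13 / 4) * (t' t - t) ^ 2 := by
      rw [← hd2]; nlinarith
    have hpos : 0 < 1 + (m - t) ^ 2 := by positivity
    calc ((t' t - t) ^ 2)⁻¹ = (13 / 4) * ((13 / 4) * (t' t - t) ^ 2)⁻¹ := by
          rw [mul_inv, ← mul_assoc, mul_inv_cancel₀ (by norm_num : (13 / 4 : ℝ) ≠ 0), one_mul]
      _ ≤ (13 / 4) * (1 + (m - t) ^ 2)⁻¹ :=
          mul_le_mul_of_nonneg_left (inv_anti₀ hpos hkey) (by norm_num)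
  have hdens := WeightedMeanValue.sum_inv_one_add_sq_le_cauchy one_pos le_rfl hT S hmem hsep m
  have hfac : (1 + m ^ 2 / (2 * T + 2) ^ 2)⁻¹ ≤ 1 :=
    inv_le_one_of_one_le₀ (le_add_of_nonneg_right (by positivity))
  calc ∑ t ∈ F, ((t' t - t) ^ 2)⁻¹ ≤ ∑ t ∈ F, (13 / 4) * (1 + (m - t) ^ 2)⁻¹ := Finset.sum_le_sum hpt
    _ ≤ ∑ t ∈ S, (13 / 4) * (1 + (m - t) ^ 2)⁻¹ :=
        Finset.sum_le_sum_of_subset_of_nonneg hFS fun _ _ _ => by positivity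
    _ = (13 / 4) * ∑ t ∈ S, (1 + (m - t) ^ 2)⁻¹ := by rw [Finset.mul_sum]
    _ ≤ (13 / 4) * ((4 * Real.pi / 1) * (1 + m ^ 2 / (2 * T + 2) ^ 2)⁻¹) := by gcongr
    _ ≤ (13 / 4) * (4 * Real.pi / 1) := by
        have h0 : 0 ≤ 4 * Real.pi / 1 := by positivity
        nlinarith
    _ = 13 * Real.pi := by ring

/-! ### §3. Maximisers of `|L(½+iu,ψ)|` on the unit intervals `[k, k+1]` -/

variable (K) in
/-- `u ↦ |L(½+iu,ψ)|` attains its maximum on each `[k, k+1]` (`L(·,ψ)` is holomorphic off `s = 1`,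
hence continuous on the critical line). [cite: ConreyIwaniec2002, §9 (9.1)] -/
theorem exists_norm_max_unit (ψ : ClassGroup (𝓞 K) →* ℂˣ) (k : ℤ) :
    ∃ u : ℝ, (k : ℝ) ≤ u ∧ u ≤ k + 1 ∧ ∀ v : ℝ, (k : ℝ) ≤ v → v ≤ k + 1 →
      ‖classGroupLFunction K ψ (1 / 2 + v * I)‖ ≤ ‖classGroupLFunction K ψ (1 / 2 + u * I)‖ := by
  have hg : Continuous fun v : ℝ => (1 / 2 : ℂ) + (v : ℂ) * I :=
    continuous_const.add (Complex.continuous_ofReal.mul continuous_const)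
  have hcomp : Continuous (classGroupLFunction K ψ ∘ fun v : ℝ => (1 / 2 : ℂ) + (v : ℂ) * I) := by
    refine continuous_iff_continuousAt.2 fun v => ?_
    have hs : (1 / 2 : ℂ) + (v : ℂ) * I ≠ 1 := by
      intro e
      have := congrArg Complex.re e
      norm_num at this
    exact ContinuousAt.comp (f := fun v : ℝ => (1 / 2 : ℂ) + (v : ℂ) * I) (x := v)
      (differentiableAt_classGroupLFunction ψ hs).continuousAt hg.continuousAt
  have hcont : Continuous fun v : ℝ => ‖classGroupLFunction K ψ (1 / 2 + v * I)‖ := hcomp.norm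
  obtain ⟨u, hu, hmax⟩ := isCompact_Icc.exists_isMaxOn (Set.nonempty_Icc.2 (by linarith))
    (hcont.continuousOn (s := Set.Icc (k : ℝ) (k + 1)))
  exact ⟨u, hu.1, hu.2, fun v hv1 hv2 => (isMaxOn_iff.mp hmax) v ⟨hv1, hv2⟩⟩

/-! ### §4. The far-companion sum against the maxima -/

/-- **`Σ_{s far} F(t′_s)/|t_s − t′_s|² ≤ 13π Σ_k F(u_k)`**, `k` over the integer parts of the
companions, for any `F ≥ 0` maximised on `[k, k+1]` at `u_k` (here `F = |L(½+i·)|²`).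
[cite: ConreyIwaniec2002, §9 (9.6)–(9.7)] -/
theorem far_sum_le_sup_sum {S Sf : Finset ℝ} {T : ℝ} (hT : 0 ≤ T) (hSf : Sf ⊆ S)
    (hmem : ∀ t ∈ S, |t| ≤ T) (hsep : ∀ t ∈ S, ∀ u ∈ S, t ≠ u → (1 : ℝ) ≤ |t - u|)
    (t' : ℝ → ℝ) (hfar : ∀ t ∈ Sf, 1 < |t' t - t|) (F : ℝ → ℝ) (hF0 : ∀ v, 0 ≤ F v)
    (u : ℤ → ℝ) (hmax : ∀ (k : ℤ) (v : ℝ), (k : ℝ) ≤ v → v ≤ k + 1 → F v ≤ F (u k)) :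
    ∑ t ∈ Sf, F (t' t) / (t' t - t) ^ 2 ≤
      13 * Real.pi * ∑ k ∈ Sf.image (fun t => ⌊t' t⌋), F (u k) := by
  classical
  have hfw := Finset.sum_fiberwise_of_maps_to (s := Sf) (t := Sf.image (fun t => ⌊t' t⌋))
    (g := fun t => ⌊t' t⌋) (fun t ht => Finset.mem_image_of_mem (fun t => ⌊t' t⌋) ht)
    (fun t => F (t' t) / (t' t - t) ^ 2)
  rw [← hfw, Finset.mul_sum]
  refine Finset.sum_le_sum fun k _ => ?_
  have hfib : ∀ t ∈ Sf.filter (fun t => ⌊t' t⌋ = k), |t' t - (k + 1 / 2)| ≤ 1 / 2 ∧ 1 < |t' t - t| := by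
    intro t ht
    rw [Finset.mem_filter] at ht
    obtain ⟨htf, hk⟩ := ht
    have h1 : (k : ℝ) ≤ t' t := by rw [← hk]; exact Int.floor_le _
    have h2 : t' t < k + 1 := by rw [← hk]; exact Int.lt_floor_add_one _
    exact ⟨abs_le.2 ⟨by linarith, by linarith⟩, hfar t htf⟩
  calc ∑ t ∈ Sf.filter (fun t => ⌊t' t⌋ = k), F (t' t) / (t' t - t) ^ 2
      ≤ ∑ t ∈ Sf.filter (fun t => ⌊t' t⌋ = k), F (u k) * ((t' t - t) ^ 2)⁻¹ := by
        refine Finset.sum_le_sum fun t ht => ?_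
        rw [div_eq_mul_inv]
        rw [Finset.mem_filter] at ht
        obtain ⟨-, hk⟩ := ht
        have h1 : (k : ℝ) ≤ t' t := by rw [← hk]; exact Int.floor_le _
        have h2 : t' t < k + 1 := by rw [← hk]; exact Int.lt_floor_add_one _
        exact mul_le_mul_of_nonneg_right (hmax k (t' t) h1 h2.le) (by positivity)
    _ = F (u k) * ∑ t ∈ Sf.filter (fun t => ⌊t' t⌋ = k), ((t' t - t) ^ 2)⁻¹ := by
        rw [Finset.mul_sum]
    _ ≤ F (u k) * (13 * Real.pi) := by
        gcongr
        · exact hF0 _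
        · exact sum_inv_sq_fiber_le hT ((Finset.filter_subset _ _).trans hSf) hmem hsep t'
            (k + 1 / 2) hfib
    _ = 13 * Real.pi * F (u k) := by ring

/-! ### §5. The maxima of one parity class: three discrete mean squares -/

/-- **One parity class of maximisers is a `1`-spaced point set**, covered by the dyadic windows at
`T/2`, `T`, `2T`: `Σ_{k∈P} F(u_k) ≤ B₁ + B₂ + B₃` when every `1`-spaced subset of `(T′, 2T′]`
(`T′ = T/2, T, 2T`) has `Σ F ≤ B_i`. [cite: ConreyIwaniec2002, Lemma 5.3; §8 (8.1)–(8.3)] -/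
theorem sum_parity_class_le (F : ℝ → ℝ) (u : ℤ → ℝ)
    (hu : ∀ k : ℤ, (k : ℝ) ≤ u k ∧ u k ≤ k + 1) (P : Finset ℤ)
    (hpar : ∀ k₁ ∈ P, ∀ k₂ ∈ P, Even (k₁ - k₂)) {T B₁ B₂ B₃ : ℝ}
    (hrange : ∀ k ∈ P, T / 2 < u k ∧ u k ≤ 4 * T)
    (h₁ : ∀ U : Finset ℝ, IsDyadicPointSet U (T / 2) → ∑ x ∈ U, F x ≤ B₁)
    (h₂ : ∀ U : Finset ℝ, IsDyadicPointSet U T → ∑ x ∈ U, F x ≤ B₂)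
    (h₃ : ∀ U : Finset ℝ, IsDyadicPointSet U (2 * T) → ∑ x ∈ U, F x ≤ B₃) :
    ∑ k ∈ P, F (u k) ≤ B₁ + B₂ + B₃ := by
  classical
  -- `u` is `1`-separated on a parity class
  have hsepP : ∀ k₁ ∈ P, ∀ k₂ ∈ P, k₁ ≠ k₂ → (1 : ℝ) ≤ |u k₁ - u k₂| := by
    intro k₁ hk₁ k₂ hk₂ hne
    have h2 : (2 : ℝ) ≤ |(k₁ : ℝ) - k₂| := by
      obtain ⟨m, hm⟩ := hpar k₁ hk₁ k₂ hk₂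
      have hm0 : m ≠ 0 := by
        rintro rfl
        apply hne
        omega
      have h1 : (1 : ℤ) ≤ |m| := Int.one_le_abs hm0
      have e : (k₁ : ℝ) - k₂ = 2 * (m : ℝ) := by
        have := congrArg (Int.cast : ℤ → ℝ) hm
        push_cast at this
        linarith
      rw [e, abs_mul, abs_two]
      have : (1 : ℝ) ≤ |(m : ℝ)| := by rw [← Int.cast_abs]; exact_mod_cast h1
      linarith
    obtain ⟨ha1, hb1⟩ := hu k₁
    obtain ⟨ha2, hb2⟩ := hu k₂
    have hdiff : |((k₁ : ℝ) - u k₁) - ((k₂ : ℝ) - u k₂)| ≤ 1 := abs_le.2 ⟨by linarith, by linarith⟩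
    have : |(k₁ : ℝ) - k₂| ≤ |u k₁ - u k₂| + 1 := by
      calc |(k₁ : ℝ) - k₂| = |(u k₁ - u k₂) + (((k₁ : ℝ) - u k₁) - ((k₂ : ℝ) - u k₂))| := by ring_nf
        _ ≤ |u k₁ - u k₂| + |((k₁ : ℝ) - u k₁) - ((k₂ : ℝ) - u k₂)| := abs_add_le _ _
        _ ≤ |u k₁ - u k₂| + 1 := by linarith
    linarith
  have hinj : Set.InjOn u P := by
    intro k₁ hk₁ k₂ hk₂ he
    by_contra hne
    have := hsepP k₁ hk₁ k₂ hk₂ hne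
    rw [he, sub_self, abs_zero] at this
    linarith
  rw [← Finset.sum_image hinj]
  set U : Finset ℝ := P.image u with hU
  have hUsep : ∀ x ∈ U, ∀ y ∈ U, x ≠ y → (1 : ℝ) ≤ |x - y| := by
    intro x hx y hy hxy
    obtain ⟨k₁, hk₁, rfl⟩ := Finset.mem_image.mp hx
    obtain ⟨k₂, hk₂, rfl⟩ := Finset.mem_image.mp hy
    exact hsepP k₁ hk₁ k₂ hk₂ fun e => hxy (by rw [e])
  have hUrange : ∀ x ∈ U, T / 2 < x ∧ x ≤ 4 * T := by
    intro x hx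
    obtain ⟨k, hk, rfl⟩ := Finset.mem_image.mp hx
    exact hrange k hk
  -- the three windows
  set U₁ := U.filter (fun x => x ≤ T) with hU₁
  set V := U.filter (fun x => ¬ x ≤ T) with hV
  set U₂ := V.filter (fun x => x ≤ 2 * T) with hU₂
  set U₃ := V.filter (fun x => ¬ x ≤ 2 * T) with hU₃
  have hsplit : ∑ x ∈ U, F x = ∑ x ∈ U₁, F x + ∑ x ∈ U₂, F x + ∑ x ∈ U₃, F x := by
    rw [← Finset.sum_filter_add_sum_filter_not U (fun x => x ≤ T),
      ← Finset.sum_filter_add_sum_filter_not (U.filter (fun x => ¬ x ≤ T)) (fun x => x ≤ 2 * T)]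
    ring
  have hU₁V : U₁ ⊆ U := Finset.filter_subset _ _
  have hVU : V ⊆ U := Finset.filter_subset _ _
  have hU₂U : U₂ ⊆ U := (Finset.filter_subset _ _).trans hVU
  have hU₃U : U₃ ⊆ U := (Finset.filter_subset _ _).trans hVU
  have hD₁ : IsDyadicPointSet U₁ (T / 2) := by
    refine ⟨fun x hx => ?_, fun x hx y hy hxy => hUsep x (hU₁V hx) y (hU₁V hy) hxy⟩
    have h := (Finset.mem_filter.1 hx).2
    have h' := (hUrange x (hU₁V hx)).1
    exact ⟨h', by linarith⟩
  have hD₂ : IsDyadicPointSet U₂ T := by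
    refine ⟨fun x hx => ?_, fun x hx y hy hxy => hUsep x (hU₂U hx) y (hU₂U hy) hxy⟩
    have h := (Finset.mem_filter.1 hx).2
    have h' := (Finset.mem_filter.1 (Finset.mem_filter.1 hx).1).2
    exact ⟨not_le.1 h', h⟩
  have hD₃ : IsDyadicPointSet U₃ (2 * T) := by
    refine ⟨fun x hx => ?_, fun x hx y hy hxy => hUsep x (hU₃U hx) y (hU₃U hy) hxy⟩
    have h := (Finset.mem_filter.1 hx).2
    have h'' := (hUrange x (hU₃U hx)).2
    exact ⟨not_le.1 h, by linarith⟩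
  rw [hsplit]
  exact add_le_add (add_le_add (h₁ U₁ hD₁) (h₂ U₂ hD₂)) (h₃ U₃ hD₃)

/-- **Both parity classes**: `Σ_{k∈𝒦} F(u_k) ≤ 2(B₁ + B₂ + B₃)`.
[cite: ConreyIwaniec2002, Lemma 5.3; §8 (8.1)–(8.3)] -/
theorem sum_sup_le (F : ℝ → ℝ) (u : ℤ → ℝ)
    (hu : ∀ k : ℤ, (k : ℝ) ≤ u k ∧ u k ≤ k + 1) (𝒦 : Finset ℤ) {T B₁ B₂ B₃ : ℝ}
    (hrange : ∀ k ∈ 𝒦, T / 2 < u k ∧ u k ≤ 4 * T)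
    (h₁ : ∀ U : Finset ℝ, IsDyadicPointSet U (T / 2) → ∑ x ∈ U, F x ≤ B₁)
    (h₂ : ∀ U : Finset ℝ, IsDyadicPointSet U T → ∑ x ∈ U, F x ≤ B₂)
    (h₃ : ∀ U : Finset ℝ, IsDyadicPointSet U (2 * T) → ∑ x ∈ U, F x ≤ B₃) :
    ∑ k ∈ 𝒦, F (u k) ≤ 2 * (B₁ + B₂ + B₃) := by
  classical
  rw [← Finset.sum_filter_add_sum_filter_not 𝒦 (fun k => Even k)]
  have he := sum_parity_class_le F u hu (𝒦.filter (fun k => Even k))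
    (fun k₁ hk₁ k₂ hk₂ => ((Finset.mem_filter.1 hk₁).2).sub (Finset.mem_filter.1 hk₂).2)
    (fun k hk => hrange k (Finset.filter_subset _ _ hk)) h₁ h₂ h₃
  have ho := sum_parity_class_le F u hu (𝒦.filter (fun k => ¬ Even k))
    (fun k₁ hk₁ k₂ hk₂ => (Int.not_even_iff_odd.1 (Finset.mem_filter.1 hk₁).2).sub_odd
      (Int.not_even_iff_odd.1 (Finset.mem_filter.1 hk₂).2))
    (fun k hk => hrange k (Finset.filter_subset _ _ hk)) h₁ h₂ h₃
  linarith

/-! ### §6. Cauchy–Schwarz -/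

/-- `Σ f g ≤ (Σ f²)^{1/2} (Σ g²)^{1/2}` (Cauchy–Schwarz, private plumbing). [folklore] -/
private theorem sum_mul_le_sqrt_mul_sqrt {ι : Type*} (s : Finset ι) (f g : ι → ℝ) :
    ∑ i ∈ s, f i * g i ≤ Real.sqrt (∑ i ∈ s, f i ^ 2) * Real.sqrt (∑ i ∈ s, g i ^ 2) := by
  rw [← Real.sqrt_mul (Finset.sum_nonneg fun i _ => sq_nonneg (f i))]
  exact (le_abs_self _).trans (Real.abs_le_sqrt (Finset.sum_mul_sq_le_sq_mul_sq s f g))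

/-! ### §7. Proposition 9.1 for companions `|t′ − t| ≤ T/4`, from Proposition 6.4 -/

/-- **CI PROPOSITION 9.1 (9.7) WITHOUT THE CLOSE-COMPANION RESTRICTION, FROM PROPOSITION 6.4.**
For `q` odd `> 4`, `K = ℚ(√−q)`, `ψ ∈ Ĉℓ(K)`, a `1`-spaced `S ⊂ (T, 2T]` with `2q^66 ≤ T`,
`2e^{(log q)²} ≤ T`, and ANY companion map with `|t′(t) − t| ≤ T/4` (close OR far):
`E(T) = Σ_{t∈S}|ℓ(s)M̄(s) − x(s)| ≤ C·(T(log q)^6 + Tℒ(T)^{1/2}(log T)²(log q)^{5/2})` — the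
conclusion VERBATIM that of `prop91_close_of_proposition64` / the I6 binder `stub_prop91_large`.
Close companions: the tree's Proposition 9.1; far companions: `far_pointwise`, Cauchy, the
maximiser trick (`far_sum_le_sup_sum`, `sum_sup_le`) and the discrete mean square of `L`
(`sum_norm_classGroupLFunction_sq_le`) in the windows at `T/2`, `T`, `2T`.
[cite: ConreyIwaniec2002, Proposition 9.1 (9.7)] -/
theorem prop91_far_of_proposition64 (h64 : conreyIwaniec2002_proposition64) :
    ∃ C : ℝ, 0 < C ∧
    ∀ (q : ℕ) [NeZero q], 4 < q → Odd q → ∀ χ : DirichletCharacter ℂ q,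
      χ.IsPrimitive → χ.IsQuadratic → χ.Odd →
        ∀ (K : Type) [Field K] [NumberField K],
          Module.finrank ℚ K = 2 → NumberField.discr K = -(q : ℤ) →
            ∀ (ψ : ClassGroup (𝓞 K) →* ℂˣ) (T : ℝ) (S : Finset ℝ) (t' : ℝ → ℝ),
              2 * (q : ℝ) ^ (66 : ℕ) ≤ T → 2 * Real.exp (Real.log q ^ (2 : ℕ)) ≤ T →
                IsDyadicPointSet S T → (∀ t ∈ S, |t' t - t| ≤ T / 4) →
                defectE K ψ q S t' ≤
                  C * (T * Real.log q ^ (6 : ℕ) +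
                    T * Real.sqrt (calL χ T) * Real.log T ^ (2 : ℕ) * Real.log q ^ ((5 : ℝ) / 2)) := by
  obtain ⟨Ccl, hCcl, hclose⟩ := prop91_close_of_proposition64 h64
  obtain ⟨CL, hCL, hL⟩ := sum_norm_classGroupLFunction_sq_le h64
  obtain ⟨C₂, hC₂, hM⟩ := sum_norm_shortInvSum_sq_le
  set CG : ℝ := 13 * Real.pi * (132 * CL) with hCG
  have hCG0 : 0 < CG := by positivity
  refine ⟨Ccl + Real.sqrt (CL * C₂) + Real.sqrt (CG * C₂) + 4, by positivity,
    fun q _ hq hodd χ hprim hquad hoddχ K _ _ h2 hdisc ψ T S t' hT hexpT hS hcomp => ?_⟩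
  classical
  -- numerics
  have hq0 : 0 < q := by omega
  have hq5 : (5 : ℝ) ≤ q := by exact_mod_cast hq
  have hpow0 : 0 ≤ (q : ℝ) ^ (66 : ℕ) := by positivity
  have hexp0 := Real.exp_pos (Real.log q ^ (2 : ℕ))
  have hT66 : (q : ℝ) ^ (66 : ℕ) ≤ T := by linarith
  have hexp1 : Real.exp (Real.log q ^ (2 : ℕ)) ≤ T := by linarith
  have hT66h : (q : ℝ) ^ (66 : ℕ) ≤ T / 2 := by linarith
  have hexph : Real.exp (Real.log q ^ (2 : ℕ)) ≤ T / 2 := by linarith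
  have hT66d : (q : ℝ) ^ (66 : ℕ) ≤ 2 * T := by linarith
  have hexpd : Real.exp (Real.log q ^ (2 : ℕ)) ≤ 2 * T := by linarith
  obtain ⟨hℓ1, hℓLT, hLT1, -, hq41, -, hT3, -⟩ := prop81_numerics hq hT66 hexp1
  have hT0 : 0 < T := by linarith
  have h625 : (5 : ℝ) ^ (4 : ℕ) ≤ (q : ℝ) ^ (4 : ℕ) := pow_le_pow_left₀ (by norm_num) hq5 4
  have hq4cast : ((q ^ 4 : ℕ) : ℝ) = (q : ℝ) ^ (4 : ℕ) := by push_cast; ring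
  have hT4 : (626 : ℝ) ≤ T := by norm_num at h625; linarith
  have hq4T : (q : ℝ) ^ (4 : ℕ) ≤ T := by linarith
  have hT2 : (2 : ℝ) ≤ T := by linarith
  set ℓ : ℝ := Real.log q with hℓ
  set LT : ℝ := Real.log T with hLT
  set cLT : ℝ := calL χ T with hcLT
  have hℓ0 : 0 ≤ ℓ := by linarith
  have hcLT0 : 0 ≤ cLT := calL_nonneg χ (by linarith)
  set X : ℝ := T * ℓ ^ (7 : ℕ) + T * cLT * LT ^ (4 : ℕ) with hX
  set Y : ℝ := T * ℓ ^ (6 : ℕ) + T * Real.sqrt cLT * LT ^ (2 : ℕ) * ℓ ^ ((5 : ℝ) / 2) with hY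
  have hX0 : 0 ≤ X := by positivity
  have hY0 : 0 ≤ Y := by positivity
  have hTY : T ≤ Y := by
    have h6 : (1 : ℝ) ≤ ℓ ^ (6 : ℕ) := one_le_pow₀ hℓ1
    have : 0 ≤ T * Real.sqrt cLT * LT ^ (2 : ℕ) * ℓ ^ ((5 : ℝ) / 2) := by positivity
    rw [hY]; nlinarith
  -- the points
  have hmem : ∀ t ∈ S, |t| ≤ 2 * T := by
    intro t ht
    have h := hS.mem_bounds ht
    rw [abs_of_pos (by linarith [h.1])]
    exact h.2
  have hsep : ∀ t ∈ S, ∀ u ∈ S, t ≠ u → (1 : ℝ) ≤ |t - u| := fun t ht u hu h => hS.2 t ht u hu h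
  have hcard : (S.card : ℝ) ≤ 2 * T := (hS.isPointSet hT2).card_le' (by linarith)
  -- split `S` into close and far companions
  set Sc := S.filter (fun t => |t' t - t| ≤ 1) with hSc
  set Sf := S.filter (fun t => ¬ |t' t - t| ≤ 1) with hSf
  have hsplit : defectE K ψ q S t' = defectE K ψ q Sc t' + defectE K ψ q Sf t' := by
    unfold defectE
    exact (Finset.sum_filter_add_sum_filter_not S _ _).symm
  have hScS : Sc ⊆ S := Finset.filter_subset _ _
  have hSfS : Sf ⊆ S := Finset.filter_subset _ _
  have hfar : ∀ t ∈ Sf, 1 < |t' t - t| := fun t ht => not_le.mp (Finset.mem_filter.1 ht).2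
  -- (1) close companions: the tree's Proposition 9.1
  have hEc : defectE K ψ q Sc t' ≤ Ccl * Y :=
    hclose q hq hodd χ hprim hquad hoddχ K h2 hdisc ψ T Sc t' hT66 hexp1 (hS.subset hScS)
      (fun t ht => (Finset.mem_filter.1 ht).2)
  -- (2) far companions, pointwise
  set Lf : ℝ → ℂ := fun v => classGroupLFunction K ψ (1 / 2 + v * I) with hLf
  set Mf : ℝ → ℂ := fun v => shortInvSum K ψ q (1 / 2 + v * I) with hMf
  have hEf : defectE K ψ q Sf t' ≤
      ∑ t ∈ Sf, (‖Lf t‖ * ‖Mf t‖ + ‖Lf (t' t)‖ * ‖Mf t‖ / |t' t - t| + 2) := by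
    unfold defectE
    exact Finset.sum_le_sum fun t ht => far_pointwise K ψ hq0 (hfar t ht)
  rw [Finset.sum_add_distrib, Finset.sum_add_distrib, Finset.sum_const, nsmul_eq_mul] at hEf
  -- the mean squares at hand
  have hD : ∑ t ∈ S, ‖Lf t‖ ^ 2 ≤ CL * (T * ℓ ^ (7 : ℕ) + T * cLT * LT ^ (4 : ℕ)) :=
    hL q hq hodd χ hprim hquad hoddχ K h2 hdisc ψ T S hT66 hexp1 hS
  have hSM : ∑ t ∈ S, ‖Mf t‖ ^ 2 ≤ C₂ * (T * ℓ ^ (5 : ℕ)) :=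
    hM q hq hodd χ hprim hquad hoddχ K h2 hdisc ψ T S hq4T hS
  -- (2a) `Σ_{far} |L(s)||M(s)| ≤ √(Σ|L|²) √(Σ|M|²) ≤ √(C_L C₂)·Y`
  have h2a : ∑ t ∈ Sf, ‖Lf t‖ * ‖Mf t‖ ≤ Real.sqrt (CL * C₂) * Y := by
    calc ∑ t ∈ Sf, ‖Lf t‖ * ‖Mf t‖ ≤ ∑ t ∈ S, ‖Lf t‖ * ‖Mf t‖ :=
          Finset.sum_le_sum_of_subset_of_nonneg hSfS fun _ _ _ => by positivity
      _ ≤ Real.sqrt (∑ t ∈ S, ‖Lf t‖ ^ 2) * Real.sqrt (∑ t ∈ S, ‖Mf t‖ ^ 2) :=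
          sum_mul_le_sqrt_mul_sqrt S _ _
      _ ≤ Real.sqrt (CL * C₂) * Y := diagonal_term_le hCL hC₂ hT0.le hℓ0 hcLT0 hD hSM
  -- (2b) the far-companion sum
  choose u hu1 hu2 humax using fun k : ℤ => exists_norm_max_unit K ψ k
  set F : ℝ → ℝ := fun v => ‖Lf v‖ ^ 2 with hF
  have hF0 : ∀ v, 0 ≤ F v := fun v => by positivity
  have hFmax : ∀ (k : ℤ) (v : ℝ), (k : ℝ) ≤ v → v ≤ k + 1 → F v ≤ F (u k) :=
    fun k v hv1 hv2 => pow_le_pow_left₀ (norm_nonneg _) (humax k v hv1 hv2) 2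
  set 𝒦 : Finset ℤ := Sf.image (fun t => ⌊t' t⌋) with h𝒦
  have hG : ∑ t ∈ Sf, F (t' t) / (t' t - t) ^ 2 ≤ 13 * Real.pi * ∑ k ∈ 𝒦, F (u k) :=
    far_sum_le_sup_sum (by positivity) hSfS hmem hsep t' hfar F hF0 u hFmax
  have hrange : ∀ k ∈ 𝒦, T / 2 < u k ∧ u k ≤ 4 * T := by
    intro k hk
    obtain ⟨t, ht, htk⟩ := Finset.mem_image.mp hk
    have htS := hS.mem_bounds (hSfS ht)
    have hc := abs_le.1 (hcomp t (hSfS ht))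
    have h1 : (k : ℝ) ≤ t' t := by rw [← htk]; exact Int.floor_le _
    have h2' : t' t < k + 1 := by rw [← htk]; exact Int.lt_floor_add_one _
    have hk1 := hu1 k
    have hk2 := hu2 k
    constructor
    · linarith [htS.1, hc.1]
    · linarith [htS.2, hc.2]
  -- the windows at `T/2`, `T`, `2T`
  have hW₁ : ∀ U : Finset ℝ, IsDyadicPointSet U (T / 2) → ∑ x ∈ U, F x ≤ CL * X := by
    intro U hU
    have h := hL q hq hodd χ hprim hquad hoddχ K h2 hdisc ψ (T / 2) U hT66h hexph hU
    refine h.trans (mul_le_mul_of_nonneg_left ?_ hCL.le)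
    have hc1 : calL χ (T / 2) ≤ cLT := calL_mono χ (by positivity) (by linarith)
    have hc0 : 0 ≤ calL χ (T / 2) := calL_nonneg χ (by linarith)
    have hl0 : 0 ≤ Real.log (T / 2) := Real.log_nonneg (by linarith)
    have hl1 : Real.log (T / 2) ≤ LT := Real.log_le_log (by positivity) (by linarith)
    have hl4 : Real.log (T / 2) ^ (4 : ℕ) ≤ LT ^ (4 : ℕ) := pow_le_pow_left₀ hl0 hl1 4
    have hl40 : 0 ≤ Real.log (T / 2) ^ (4 : ℕ) := by positivity
    have hℓ7 : 0 ≤ ℓ ^ (7 : ℕ) := by positivity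
    rw [hX]
    apply add_le_add
    · have : 0 ≤ T / 2 * ℓ ^ (7 : ℕ) := by positivity
      linarith
    · have hh : T / 2 * calL χ (T / 2) * Real.log (T / 2) ^ (4 : ℕ) ≤ T * cLT * LT ^ (4 : ℕ) := by
        gcongr
        linarith
      exact hh
  have hW₂ : ∀ U : Finset ℝ, IsDyadicPointSet U T → ∑ x ∈ U, F x ≤ CL * X := by
    intro U hU
    exact hL q hq hodd χ hprim hquad hoddχ K h2 hdisc ψ T U hT66 hexp1 hU
  have hW₃ : ∀ U : Finset ℝ, IsDyadicPointSet U (2 * T) → ∑ x ∈ U, F x ≤ 64 * (CL * X) := by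
    intro U hU
    have h := hL q hq hodd χ hprim hquad hoddχ K h2 hdisc ψ (2 * T) U hT66d hexpd hU
    refine h.trans ?_
    have hc1 : calL χ (2 * T) ≤ 2 * cLT := calL_two_mul_le χ hT2
    have hc0 : 0 ≤ calL χ (2 * T) := calL_nonneg χ (by linarith)
    have hl2 : Real.log 2 ≤ LT := Real.log_le_log (by norm_num) hT2
    have hlog2T : Real.log (2 * T) = Real.log 2 + LT := by
      rw [hLT, Real.log_mul (by norm_num) hT0.ne']
    have hl1 : Real.log (2 * T) ≤ 2 * LT := by rw [hlog2T]; linarith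
    have hl0 : 0 ≤ Real.log (2 * T) := Real.log_nonneg (by linarith)
    have hl4 : Real.log (2 * T) ^ (4 : ℕ) ≤ (2 * LT) ^ (4 : ℕ) := pow_le_pow_left₀ hl0 hl1 4
    have hl40 : 0 ≤ Real.log (2 * T) ^ (4 : ℕ) := by positivity
    have hℓ7 : 0 ≤ ℓ ^ (7 : ℕ) := by positivity
    have hLT0 : 0 ≤ LT := by linarith
    have : 2 * T * ℓ ^ (7 : ℕ) + 2 * T * calL χ (2 * T) * Real.log (2 * T) ^ (4 : ℕ) ≤ 64 * X := by
      rw [hX]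
      have e : (2 * LT) ^ (4 : ℕ) = 16 * LT ^ (4 : ℕ) := by ring
      rw [e] at hl4
      have h1 : 2 * T * calL χ (2 * T) * Real.log (2 * T) ^ (4 : ℕ) ≤
          2 * T * (2 * cLT) * (16 * LT ^ (4 : ℕ)) := by gcongr
      have h0 : 0 ≤ T * ℓ ^ (7 : ℕ) := by positivity
      have e1 : 2 * T * (2 * cLT) * (16 * LT ^ (4 : ℕ)) = 64 * (T * cLT * LT ^ (4 : ℕ)) := by ring
      rw [e1] at h1
      linarith
    calc CL * (2 * T * ℓ ^ (7 : ℕ) + 2 * T * calL χ (2 * T) * Real.log (2 * T) ^ (4 : ℕ))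
        ≤ CL * (64 * X) := mul_le_mul_of_nonneg_left this hCL.le
      _ = 64 * (CL * X) := by ring
  have hsup : ∑ k ∈ 𝒦, F (u k) ≤ 2 * (CL * X + CL * X + 64 * (CL * X)) :=
    sum_sup_le F u (fun k => ⟨hu1 k, hu2 k⟩) 𝒦 hrange hW₁ hW₂ hW₃
  have hGX : ∑ t ∈ Sf, F (t' t) / (t' t - t) ^ 2 ≤ CG * (T * ℓ ^ (7 : ℕ) + T * cLT * LT ^ (4 : ℕ)) := by
    refine hG.trans ?_
    have : 13 * Real.pi * ∑ k ∈ 𝒦, F (u k) ≤ 13 * Real.pi * (2 * (CL * X + CL * X + 64 * (CL * X))) :=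
      mul_le_mul_of_nonneg_left hsup (by positivity)
    refine this.trans (le_of_eq ?_)
    rw [hCG, hX]; ring
  have h2b : ∑ t ∈ Sf, ‖Lf (t' t)‖ * ‖Mf t‖ / |t' t - t| ≤ Real.sqrt (CG * C₂) * Y := by
    have hSMf : ∑ t ∈ Sf, ‖Mf t‖ ^ 2 ≤ C₂ * (T * ℓ ^ (5 : ℕ)) :=
      (Finset.sum_le_sum_of_subset_of_nonneg hSfS fun _ _ _ => by positivity).trans hSM
    calc ∑ t ∈ Sf, ‖Lf (t' t)‖ * ‖Mf t‖ / |t' t - t|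
        = ∑ t ∈ Sf, (‖Lf (t' t)‖ / |t' t - t|) * ‖Mf t‖ := by
          refine Finset.sum_congr rfl fun t _ => ?_; ring
      _ ≤ Real.sqrt (∑ t ∈ Sf, (‖Lf (t' t)‖ / |t' t - t|) ^ 2) * Real.sqrt (∑ t ∈ Sf, ‖Mf t‖ ^ 2) :=
          sum_mul_le_sqrt_mul_sqrt Sf _ _
      _ = Real.sqrt (∑ t ∈ Sf, F (t' t) / (t' t - t) ^ 2) * Real.sqrt (∑ t ∈ Sf, ‖Mf t‖ ^ 2) := by
          congr 2
          refine Finset.sum_congr rfl fun t _ => ?_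
          rw [hF, div_pow, sq_abs]
      _ ≤ Real.sqrt (CG * C₂) * Y := diagonal_term_le hCG0 hC₂ hT0.le hℓ0 hcLT0 hGX hSMf
  -- (2c) the constant `2` per far point
  have h2c : (2 : ℝ) * (Sf.card : ℝ) ≤ 4 * Y := by
    have : (Sf.card : ℝ) ≤ S.card := by exact_mod_cast Finset.card_le_card hSfS
    linarith
  -- assemble
  have hfarY : defectE K ψ q Sf t' ≤ (Real.sqrt (CL * C₂) + Real.sqrt (CG * C₂) + 4) * Y := by
    have hexpand : (Real.sqrt (CL * C₂) + Real.sqrt (CG * C₂) + 4) * Y =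
        Real.sqrt (CL * C₂) * Y + Real.sqrt (CG * C₂) * Y + 4 * Y := by ring
    rw [hexpand]
    linarith [hEf, h2a, h2b, h2c]
  have hcomb : (Ccl + Real.sqrt (CL * C₂) + Real.sqrt (CG * C₂) + 4) * Y =
      Ccl * Y + (Real.sqrt (CL * C₂) + Real.sqrt (CG * C₂) + 4) * Y := by ring
  rw [hsplit, hcomb]
  exact add_le_add hEc hfarY

end ConreyIwaniec2002

end Literature.NumberTheory.LFunctions

end
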